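import Literature.NumberTheory.EllipticCurves.LeadingTermBSZOrdDensityProofs
import Literature.NumberTheory.EllipticCurves.LeadingTermBSZOrdinaryProofs
import Literature.NumberTheory.EllipticCurves.PAdicHeightsTateValuationProofs
import Literature.NumberTheory.EllipticCurves.HeightDensityLemmas
import Literature.NumberTheory.EllipticCurves.BSDRankZeroFamily
import Mathlib.NumberTheory.SumPrimeReciprocals
import Mathlib.Analysis.SpecialFunctions.Exp
import HarnessLib

/-!
# Bhargava–Skinner–Zhang, Lemma 20 (second property), proved: almost every `E_{A,B}` has two
# primes `ℓ ∥ N` with `v_ℓ(Δ) = 1`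

Source: M. Bhargava, C. Skinner, W. Zhang, *A majority of elliptic curves over `ℚ` satisfy the
Birch and Swinnerton-Dyer conjecture*, arXiv:1407.1826 (2014), Lemma 20 (p. 10):

> "Let `p` be any prime. Then, when ordered by height, a density of 100% of elliptic curves `E`
> over `ℚ` possess the following two properties: • `E[p]` is an irreducible `Gal(ℚ̄/ℚ)`-module;
> • There exist at least two prime factors `ℓ ∥ N(E)`, `ℓ ≠ p`, such that `E[p]` is ramified at `ℓ`."

and its printed proof of the second property (p. 10, lines 31–37 of the held text): with
`S(L, ℓ) := {E_{A,B} : ord_ℓ(Δ(A,B)) ≤ 1 and ord_q(Δ(A,B)) ≠ 1 for all primes 5 ≤ q ≤ L,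
q ∉ {ℓ, p}}` and `S(L) := ⋃_{5 ≤ ℓ ≤ L, ℓ ≠ p} S(L, ℓ)`, "any curve in the complement of `S(L)`
satisfies the second property of the lemma with two primes `5 ≤ ℓ₁, ℓ₂ ≤ L`. So it suffices to
show that `μ(S(L))` tends to `0` as `L` gets large", which the source does by multiplying local
densities (`μ_q{ord_q Δ = 1} ~ 1/q`, `Σ 1/q = ∞`).

Remark on the source (the tree's `LeadingTermBSZMuDiffProofs`, "Remark on the source", and the
bsd-percentage cell's referee ruling R157.2). As PRINTED the argument does not go through: with
`ord_ℓ(Δ) ≤ 1` the sets `S(L, ℓ)` are not disjoint and the displayed value of `μ(S(L))` (a sum over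
`ℓ` of products of local densities) does not tend to `0` — it is `≍ L / log² L` —, and "the
complement of `S(L)`" also contains the curves with NO prime `5 ≤ q ≤ L` of `ord_q Δ = 1`, which do
not have the second property. The REPAIR is elementary and is what this file formalizes: use the
exact-order-one local condition `{q ∤ A, ord_q Δ = 1}` (density `δ_q = (q-1)²/q³` up to the family's
factor), and bound separately the curves with no such `q ≤ L` (`∏_q (1 - δ_q) → 0`) and those with
exactly one (`Σ_ℓ δ_ℓ ∏_{q ≠ ℓ} (1 - δ_q)`, also `→ 0`). The STATEMENT proved is the `p`-UNIFORM
form (two primes `ℓ₁ ≠ ℓ₂` with `ord_{ℓᵢ} Δ = 1`, hence `E[p]` ramified at both for every `p`), which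
implies Lemma 20's second property for each `p`.

This file PROVES: **a
(lower) naive-height density one of pairs `(A, B)` have two distinct primes `ℓ₁, ℓ₂ ≥ 5` with
`ℓᵢ ∤ A` and `ord_{ℓᵢ}(4A³ + 27B²) = 1`** (`TwoMultPrimes.heightDensityGE_twoOrdOnePrimes`, restated at
top level as `heightDensityGE_twoPrimes_ordDisc_eq_one`), and its consequence
in the vocabulary of the tree's `p`-part statements: **for every globally minimal model `W` of
`E_{A,B}`, two distinct primes of multiplicative reduction with `v_ℓ(Δ_min(W)) = 1`**
(`heightDensityGE_twoMultiplicativePrimes`) — the binder `TwoMultPrimesDensityOne` ("(F3) with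
`k = 2`") of the bsd-percentage cell's `PERCENT-FULL.md` §5, there labelled `F3-k2-kernel-owed`.

## Proof architecture (the source's sieve, repaired as above, with an explicit tail bound)

* §1–§2: a condition on `(A, B)` that is periodic modulo `N` is membership of
  `(A mod N, B mod N)` in a residue set `R_N ⊆ (ℤ/N)²`; for coprime moduli the residue set of a
  conjunction is the product of the residue sets (Chinese remainder theorem,
  `ZMod.chineseRemainder`), so residue proportions multiply — the "product of local densities".
* §3: for an `N`-periodic condition, the proportion among curves of height `< X` is eventually at
  most `2 · #R_N/N² + ε` (count residue classes in the box `4|A|³ < X`, `27B² < X` and divide by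
  `#{H < X} ~ c_F X^{5/6}`, `c_F ≥ c₀/2`; Bhargava–Shankar's Lemma 5.15 as discharged in
  `BhargavaShankarCountingProofs`). Only this UPPER bound is needed, so the minimality condition of
  the family can be dropped and no Euler factor enters.
* §4: the local input at one prime `q ≥ 5`: the residue set modulo `q²` of
  `{q ∤ A, ord_q(4A³+27B²) = 1}` has exactly `q(q-1)²` elements, i.e. proportion
  `δ_q = (q-1)²/q³` — read off from the tree's one-prime density theorems
  (`hasHeightDensity_padicValInt_disc_eq`, `hasHeightDensity_residues`) by uniqueness of limits.
* §5: over a finite set `P` of primes `≥ 5`, with `s_P = Σ_{q ∈ P} δ_q`: the residue proportion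
  of "no `q ∈ P` hits" is `∏ (1 - δ_q) ≤ e^{-s_P}` and of "at most one `q ∈ P` hits" is
  `≤ (1 + 2 s_P) e^{-s_P}` (induction on `P` via §2; `δ_q ≤ 1/2`).
* §6: `Σ_q δ_q = ∞` (`δ_q ≥ (16/25)/q` and Mathlib's `Nat.Primes.not_summable_one_div`), so `s_P`
  can be made large and the exceptional proportion small: density one.
* §7: the bridge to minimal models: for `(A, B)` in the family, `q ≥ 5` with
  `ord_q(4A³+27B²) = 1`, `q ∤ A`, and any globally minimal `W ≅ E_{A,B}`: `W` has multiplicative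
  reduction at `q` (reduction types of `E_{A,B}` at `q ≥ 5`, `LeadingTermBSZReductionTypesProofs`,
  transported along the isomorphism) and `v_q(Δ_min(W)) = 1` (a globally minimal equation is
  `ℤ_q`-minimal, `isMinimal_baseChange_padic_of_isGloballyMinimal`, so `v_q(Δ_min) ≤ v_q Δ(A,B) = 1`,
  and `v_q(Δ_min) ≡ v_q Δ(A,B) (mod 12)`).

Everything here is PROVED; no definitions of mathematical content beyond bookkeeping abbreviations,
no named facts (D-0026).

## References

* M. Bhargava, C. Skinner, W. Zhang, arXiv:1407.1826 (2014), Lemma 20 and its proof (p. 10).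
  [cite: BhargavaSkinnerZhang2014, Lemma 20 (proof, p. 10)]
* M. Bhargava, A. Shankar, Ann. of Math. (2) 181 (2015) 191–242, Lemma 5.15 (the count of the
  family). [cite: BhargavaShankarAnnals2015, Lemma 5.15]
* J. H. Silverman, *The Arithmetic of Elliptic Curves*, 2nd ed. (2009), VII.1 (minimal equations),
  VII.5 Prop. 5.1 (reduction types), VIII.8 (global minimal models).
  [cite: SilvermanAEC2009, VII.1, VII.5 Prop. 5.1, VIII.8]
-/

noncomputable section

open scoped Classical
open Filter Topology

namespace Literature.NumberTheory.EllipticCurves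

namespace TwoMultPrimes

/-! ## §1 Periodic conditions and their residue sets -/

/-- A condition on integer pairs is `N`-periodic if it only depends on `(A mod N, B mod N)`.
[folklore] -/
def IsPeriodic (N : ℕ) (Q : ℤ × ℤ → Prop) : Prop :=
  ∀ AB AB' : ℤ × ℤ, AB.1 ≡ AB'.1 [ZMOD N] → AB.2 ≡ AB'.2 [ZMOD N] → (Q AB ↔ Q AB')

/-- The residue set of a condition modulo `N`: the residue pairs whose canonical representatives
satisfy it. [folklore] -/
def residues (N : ℕ) [NeZero N] (Q : ℤ × ℤ → Prop) : Finset (ZMod N × ZMod N) :=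
  Finset.univ.filter fun x ↦ Q ((x.1.val : ℤ), (x.2.val : ℤ))

/-- A condition periodic modulo `M` is periodic modulo any multiple of `M`. [folklore] -/
theorem IsPeriodic.of_dvd {M N : ℕ} {Q : ℤ × ℤ → Prop} (hQ : IsPeriodic M Q) (h : M ∣ N) :
    IsPeriodic N Q := fun _ _ h1 h2 ↦
  hQ _ _ (Int.ModEq.of_dvd (Int.natCast_dvd_natCast.mpr h) h1)
    (Int.ModEq.of_dvd (Int.natCast_dvd_natCast.mpr h) h2)

/-- Conjunctions of periodic conditions are periodic. [folklore] -/
theorem IsPeriodic.and {N : ℕ} {Q Q' : ℤ × ℤ → Prop} (hQ : IsPeriodic N Q) (hQ' : IsPeriodic N Q') :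
    IsPeriodic N (fun AB ↦ Q AB ∧ Q' AB) := fun _ _ h1 h2 ↦
  and_congr (hQ _ _ h1 h2) (hQ' _ _ h1 h2)

/-- Disjunctions of periodic conditions are periodic. [folklore] -/
theorem IsPeriodic.or {N : ℕ} {Q Q' : ℤ × ℤ → Prop} (hQ : IsPeriodic N Q) (hQ' : IsPeriodic N Q') :
    IsPeriodic N (fun AB ↦ Q AB ∨ Q' AB) := fun _ _ h1 h2 ↦
  or_congr (hQ _ _ h1 h2) (hQ' _ _ h1 h2)

/-- Negations of periodic conditions are periodic. [folklore] -/
theorem IsPeriodic.not {N : ℕ} {Q : ℤ × ℤ → Prop} (hQ : IsPeriodic N Q) :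
    IsPeriodic N (fun AB ↦ ¬ Q AB) := fun _ _ h1 h2 ↦
  not_congr (hQ _ _ h1 h2)

/-- The trivial condition is periodic. [folklore] -/
theorem isPeriodic_true (N : ℕ) : IsPeriodic N (fun _ ↦ True) := fun _ _ _ _ ↦ Iff.rfl

/-- The canonical representative of `A mod N` is congruent to `A`. [folklore] -/
theorem val_intCast_modEq (N : ℕ) [NeZero N] (A : ℤ) : ((A : ZMod N).val : ℤ) ≡ A [ZMOD N] := by
  rw [ZMod.val_intCast]
  exact Int.emod_emod_of_dvd _ (dvd_refl _) |>.symm ▸ Int.mod_modEq A N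

/-- **Membership lemma**: an `N`-periodic condition holds at `(A, B)` iff `(A mod N, B mod N)` lies in
its residue set. [folklore] -/
theorem mem_residues_iff {N : ℕ} [NeZero N] {Q : ℤ × ℤ → Prop} (hQ : IsPeriodic N Q) (AB : ℤ × ℤ) :
    ((AB.1 : ZMod N), (AB.2 : ZMod N)) ∈ residues N Q ↔ Q AB := by
  rw [residues, Finset.mem_filter]
  simp only [Finset.mem_univ, true_and]
  exact hQ _ _ (val_intCast_modEq N AB.1) (val_intCast_modEq N AB.2)

/-- The residue set of the trivial condition is everything. [folklore] -/
theorem residues_true (N : ℕ) [NeZero N] : residues N (fun _ ↦ True) = Finset.univ := by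
  simp [residues]

/-- A residue set modulo `N` has at most `N²` elements. [folklore] -/
theorem card_residues_le (N : ℕ) [NeZero N] (Q : ℤ × ℤ → Prop) :
    (residues N Q).card ≤ N ^ 2 := by
  calc (residues N Q).card ≤ (Finset.univ : Finset (ZMod N × ZMod N)).card :=
        Finset.card_le_card (Finset.filter_subset _ _)
    _ = N ^ 2 := by simp [Finset.card_univ, ZMod.card, sq]

/-- Residue sets of conditions disjoint modulo `N` add. [folklore] -/
theorem card_residues_or_of_disjoint {N : ℕ} [NeZero N] {Q Q' : ℤ × ℤ → Prop}
    (h : ∀ AB, Q AB → ¬ Q' AB) :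
    (residues N (fun AB ↦ Q AB ∨ Q' AB)).card = (residues N Q).card + (residues N Q').card := by
  have hu : residues N (fun AB ↦ Q AB ∨ Q' AB) = residues N Q ∪ residues N Q' := by
    ext x
    simp only [residues, Finset.mem_filter, Finset.mem_univ, true_and, Finset.mem_union]
  rw [hu, Finset.card_union_of_disjoint]
  rw [residues, residues]
  exact Finset.disjoint_filter.mpr fun x _ hx hx' ↦ h _ hx hx'

/-! ## §2 The Chinese remainder theorem: residue sets of coprime moduli multiply -/

/-- The canonical representative of the reduction of `x mod (m n)` to `ℤ/m` is congruent to that of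
`x`. [folklore] -/
theorem val_cast_modEq {m n : ℕ} [NeZero m] [NeZero n] (x : ZMod (m * n)) :
    (((ZMod.castHom (dvd_mul_right m n) (ZMod m) x).val : ℤ)) ≡ (x.val : ℤ) [ZMOD m] := by
  rw [ZMod.castHom_apply, ZMod.cast_eq_val, ZMod.val_natCast, Int.natCast_mod]
  exact Int.mod_modEq _ _

/-- The canonical representative of the reduction of `x mod (m n)` to `ℤ/n` is congruent to that of
`x`. [folklore] -/
theorem val_cast_modEq' {m n : ℕ} [NeZero m] [NeZero n] (x : ZMod (m * n)) :
    (((ZMod.castHom (dvd_mul_left n m) (ZMod n) x).val : ℤ)) ≡ (x.val : ℤ) [ZMOD n] := by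
  rw [ZMod.castHom_apply, ZMod.cast_eq_val, ZMod.val_natCast, Int.natCast_mod]
  exact Int.mod_modEq _ _

/-- **CRT for residue sets**: for coprime `m`, `n`, an `m`-periodic `Q` and an `n`-periodic `Q'`,
`#R_{mn}(Q ∧ Q') = #R_m(Q) · #R_n(Q')`. [folklore] -/
theorem card_residues_and_of_coprime {m n : ℕ} [NeZero m] [NeZero n] (hmn : m.Coprime n)
    {Q Q' : ℤ × ℤ → Prop} (hQ : IsPeriodic m Q) (hQ' : IsPeriodic n Q') :
    haveI : NeZero (m * n) := ⟨mul_ne_zero (NeZero.ne m) (NeZero.ne n)⟩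
    (residues (m * n) (fun AB ↦ Q AB ∧ Q' AB)).card =
      (residues m Q).card * (residues n Q').card := by
  haveI : NeZero (m * n) := ⟨mul_ne_zero (NeZero.ne m) (NeZero.ne n)⟩
  set e : ZMod (m * n) ≃+* ZMod m × ZMod n := ZMod.chineseRemainder hmn with he
  have he1 : ∀ x : ZMod (m * n), (e x).1 = ZMod.castHom (dvd_mul_right m n) (ZMod m) x := by
    intro x
    show (ZMod.cast x : ZMod m × ZMod n).1 = _
    rw [Prod.fst_zmod_cast, ZMod.castHom_apply]
  have he2 : ∀ x : ZMod (m * n), (e x).2 = ZMod.castHom (dvd_mul_left n m) (ZMod n) x := by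
    intro x
    show (ZMod.cast x : ZMod m × ZMod n).2 = _
    rw [Prod.snd_zmod_cast, ZMod.castHom_apply]
  -- the bijection on pairs
  set E : ZMod (m * n) × ZMod (m * n) ≃ (ZMod m × ZMod m) × (ZMod n × ZMod n) :=
    ((e.toEquiv.prodCongr e.toEquiv).trans (Equiv.prodProdProdComm _ _ _ _)) with hE
  rw [← Finset.card_product, residues, residues, residues, ← Finset.filter_product,
    Finset.univ_product_univ]
  refine Finset.card_equiv E fun x ↦ ?_
  simp only [Finset.mem_filter, Finset.mem_univ, true_and, hE, Equiv.trans_apply,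
    Equiv.prodCongr_apply, Prod.map, Equiv.prodProdProdComm_apply, RingEquiv.toEquiv_eq_coe,
    EquivLike.coe_coe]
  rw [he1, he1, he2, he2]
  refine and_congr ?_ ?_
  · exact (hQ _ _ (val_cast_modEq x.1) (val_cast_modEq x.2)).symm
  · exact (hQ' _ _ (val_cast_modEq' x.1) (val_cast_modEq' x.2)).symm

/-! ## §3 Upper bound for the height proportion of a periodic condition -/

open HeightCount

/-- One residue class modulo `N` meets `{k : |k| < R}` in at most `2R/N + 2` integers. [folklore] -/
theorem card_filter_intCast_eq_le {R : ℝ} (hR : 0 < R) (N : ℕ) [NeZero N] (r : ZMod N) :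
    (((intBall R).filter (fun k : ℤ ↦ (k : ZMod N) = r)).card : ℝ) ≤ 2 * R / N + 2 := by
  have hN : (0 : ℤ) < (N : ℤ) := by exact_mod_cast Nat.pos_of_ne_zero (NeZero.ne N)
  have hiff : ∀ k : ℤ, (k : ZMod N) = r ↔ k ≡ (r.val : ℤ) [ZMOD (N : ℤ)] := by
    intro k
    rw [← ZMod.intCast_eq_intCast_iff, Int.cast_natCast, ZMod.natCast_zmod_val]
  rw [Finset.filter_congr (fun k _ ↦ hiff k)]
  have h := abs_card_filter_modEq_intBall_sub_le hR hN (r.val : ℤ)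
  rw [Int.cast_natCast] at h
  linarith [(abs_le.mp h).2]

/-- **Box count of a periodic condition**: an `N`-periodic condition holds at no more than
`#R_N · (2R₁/N + 2)(2R₂/N + 2)` pairs of the box `4|A|³ < X`, `27B² < X`. [folklore] -/
theorem card_box_filter_le {N : ℕ} [NeZero N] {Q : ℤ × ℤ → Prop} (hQ : IsPeriodic N Q) {X : ℕ}
    (hX : 1 ≤ X) :
    (((box X).filter Q).card : ℝ) ≤
      (residues N Q).card * ((2 * R₁ X / N + 2) * (2 * R₂ X / N + 2)) := by
  set f : ℤ × ℤ → ZMod N × ZMod N := fun AB ↦ ((AB.1 : ZMod N), (AB.2 : ZMod N)) with hf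
  have hfilt : (box X).filter Q = (box X).filter (fun AB ↦ f AB ∈ residues N Q) :=
    Finset.filter_congr fun AB _ ↦ (mem_residues_iff hQ AB).symm
  rw [hfilt]
  have hfib : ((box X).filter (fun AB ↦ f AB ∈ residues N Q)).card =
      ∑ r ∈ residues N Q, (((box X).filter (fun AB ↦ f AB ∈ residues N Q)).filter
        (fun AB ↦ f AB = r)).card :=
    Finset.card_eq_sum_card_fiberwise fun AB hAB ↦ (Finset.mem_filter.mp hAB).2
  rw [hfib, Nat.cast_sum]
  have hterm : ∀ r ∈ residues N Q, ((((box X).filter (fun AB ↦ f AB ∈ residues N Q)).filter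
      (fun AB ↦ f AB = r)).card : ℝ) ≤ (2 * R₁ X / N + 2) * (2 * R₂ X / N + 2) := by
    intro r _
    have hsub : ((box X).filter (fun AB ↦ f AB ∈ residues N Q)).filter (fun AB ↦ f AB = r) ⊆
        (intBall (R₁ X)).filter (fun k : ℤ ↦ (k : ZMod N) = r.1) ×ˢ
          (intBall (R₂ X)).filter (fun k : ℤ ↦ (k : ZMod N) = r.2) := by
      intro AB hAB
      simp only [Finset.mem_filter, box, Finset.mem_product, hf, Prod.ext_iff] at hAB
      simp only [Finset.mem_product, Finset.mem_filter]
      exact ⟨⟨hAB.1.1.1, hAB.2.1⟩, ⟨hAB.1.1.2, hAB.2.2⟩⟩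
    have h1 := card_filter_intCast_eq_le (R₁_pos hX) N r.1
    have h2 := card_filter_intCast_eq_le (R₂_pos hX) N r.2
    have h0 : (0 : ℝ) ≤ (((intBall (R₂ X)).filter (fun k : ℤ ↦ (k : ZMod N) = r.2)).card : ℝ) :=
      Nat.cast_nonneg _
    calc ((((box X).filter (fun AB ↦ f AB ∈ residues N Q)).filter (fun AB ↦ f AB = r)).card : ℝ)
        ≤ (((intBall (R₁ X)).filter (fun k : ℤ ↦ (k : ZMod N) = r.1) ×ˢ
            (intBall (R₂ X)).filter (fun k : ℤ ↦ (k : ZMod N) = r.2)).card : ℝ) := by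
          exact_mod_cast Finset.card_le_card hsub
      _ = (((intBall (R₁ X)).filter (fun k : ℤ ↦ (k : ZMod N) = r.1)).card : ℝ) *
            (((intBall (R₂ X)).filter (fun k : ℤ ↦ (k : ZMod N) = r.2)).card : ℝ) := by
          rw [Finset.card_product, Nat.cast_mul]
      _ ≤ (2 * R₁ X / N + 2) * (2 * R₂ X / N + 2) :=
          mul_le_mul h1 h2 h0 (by linarith [h1])
  refine (Finset.sum_le_sum hterm).trans ?_
  rw [Finset.sum_const, nsmul_eq_mul]

/-- The constant of the family count is at least half the area constant:
`c_F = c₀ ∏_p (1 - p⁻¹⁰) ≥ c₀/2`. [folklore] -/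
theorem half_area_le_heightFamilyConstant :
    4 / ((4 : ℝ) ^ (1 / 3 : ℝ) * (27 : ℝ) ^ (1 / 2 : ℝ)) / 2 ≤ heightFamilyConstant := by
  unfold heightFamilyConstant
  have hc₀ : (0 : ℝ) < 4 / ((4 : ℝ) ^ (1 / 3 : ℝ) * (27 : ℝ) ^ (1 / 2 : ℝ)) := by positivity
  have hprod : (1 / 2 : ℝ) ≤ ∏' p : Nat.Primes, (1 - 1 / ((p : ℕ) : ℝ) ^ 10) := by
    by_cases hm : Multipliable (fun p : Nat.Primes ↦ (1 - 1 / ((p : ℕ) : ℝ) ^ 10))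
    · exact ge_of_tendsto' hm.hasProd fun s ↦ half_le_prod_primes s
    · rw [tprod_eq_one_of_not_multipliable hm]; norm_num
  calc 4 / ((4 : ℝ) ^ (1 / 3 : ℝ) * (27 : ℝ) ^ (1 / 2 : ℝ)) / 2
      = 4 / ((4 : ℝ) ^ (1 / 3 : ℝ) * (27 : ℝ) ^ (1 / 2 : ℝ)) * (1 / 2) := by ring
    _ ≤ _ := mul_le_mul_of_nonneg_left hprod hc₀.le

/-- **Upper bound for the proportion of a periodic condition.** For an `N`-periodic condition `Q`
with residue set `R_N`, the proportion of curves `E_{A,B}` of height `< X` satisfying `Q` is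
eventually at most `2 · #R_N / N² + ε` (the minimality condition of the family only lowers the
count; `#{H < X} ~ c_F X^{5/6}` with `c_F ≥ c₀/2`). [folklore] -/
theorem eventually_heightProportion_le {N : ℕ} [NeZero N] {Q : ℤ × ℤ → Prop} (hQ : IsPeriodic N Q)
    {ε : ℝ} (hε : 0 < ε) :
    ∀ᶠ X : ℕ in atTop,
      heightProportion Q X ≤ 2 * ((residues N Q).card / (N : ℝ) ^ 2) + ε := by
  set c₀ : ℝ := 4 / ((4 : ℝ) ^ (1 / 3 : ℝ) * (27 : ℝ) ^ (1 / 2 : ℝ)) with hc₀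
  set K : ℝ := ((residues N Q).card : ℝ) with hK
  have hc₀pos : 0 < c₀ := by rw [hc₀]; positivity
  have hN : (0 : ℝ) < N := by exact_mod_cast Nat.pos_of_ne_zero (NeZero.ne N)
  have hKnn : 0 ≤ K := Nat.cast_nonneg _
  -- the numerator bound divided by `X^{5/6}` tends to `K c₀ / N²`
  set T : ℕ → ℝ := fun X ↦ K * ((2 * R₁ X / N + 2) * (2 * R₂ X / N + 2)) / (X : ℝ) ^ (5 / 6 : ℝ)
    with hT
  have hTlim : Tendsto T atTop (𝓝 (K * c₀ / (N : ℝ) ^ 2)) := by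
    have h := (((tendsto_R₁_div.const_mul (4 / (N : ℝ))).add
      (tendsto_R₂_div.const_mul (4 / (N : ℝ)))).add (tendsto_one_div.const_mul 4)).const_add
        (c₀ / (N : ℝ) ^ 2)
    have h' := h.const_mul K
    simp only [mul_zero, add_zero] at h'
    rw [show K * (c₀ / (N : ℝ) ^ 2) = K * c₀ / (N : ℝ) ^ 2 by ring] at h'
    refine h'.congr' ?_
    filter_upwards [eventually_ge_atTop 1] with X hX
    have h4 := four_R₁R₂_div hX
    rw [← hc₀] at h4
    simp only [hT]
    rw [← h4]
    field_simp
    ring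
  have hD : Tendsto (fun X : ℕ ↦ ((heightFamilyBelow X).card : ℝ) / (X : ℝ) ^ (5 / 6 : ℝ)) atTop
      (𝓝 heightFamilyConstant) := card_heightFamilyBelow_asymptotic_holds
  have hq := hTlim.div hD heightFamilyConstant_pos.ne'
  -- the limit is at most `2 K / N²`
  have hlim : K * c₀ / (N : ℝ) ^ 2 / heightFamilyConstant ≤ 2 * (K / (N : ℝ) ^ 2) := by
    have hcF := half_area_le_heightFamilyConstant
    rw [← hc₀] at hcF
    rw [div_le_iff₀ heightFamilyConstant_pos]
    have : K * c₀ / (N : ℝ) ^ 2 = 2 * (K / (N : ℝ) ^ 2) * (c₀ / 2) := by ring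
    rw [this]
    exact mul_le_mul_of_nonneg_left hcF (by positivity)
  have hev := hq.eventually (Iic_mem_nhds (lt_add_of_le_of_pos hlim hε))
  filter_upwards [hev, eventually_ge_atTop 28] with X hX hX28
  have hX1 : 1 ≤ X := le_trans (by norm_num) hX28
  have hP : (0 : ℝ) < (X : ℝ) ^ (5 / 6 : ℝ) := Real.rpow_pos_of_pos (by exact_mod_cast hX1) _
  have hFpos : (0 : ℝ) < (heightFamilyBelow X).card := by
    exact_mod_cast Finset.card_pos.mpr ⟨_, zeroOne_mem_heightFamilyBelow hX28⟩
  refine le_trans ?_ hX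
  simp only [Pi.div_apply, hT]
  rw [div_div_div_cancel_right₀ hP.ne', heightProportion_eq_card_div, div_le_div_iff_of_pos_right hFpos]
  calc (((heightFamilyBelow X).filter Q).card : ℝ) ≤ ((box X).filter Q).card := by
        rw [heightFamilyBelow_eq, Finset.filter_filter]
        exact_mod_cast Finset.card_le_card (fun AB hAB ↦ by
          rw [Finset.mem_filter] at hAB ⊢
          exact ⟨hAB.1, hAB.2.2⟩)
    _ ≤ K * ((2 * R₁ X / N + 2) * (2 * R₂ X / N + 2)) := card_box_filter_le hQ hX1

/-- Corollary: if `Q` is `N`-periodic with residue proportion `#R_N/N² ≤ η`, then the complement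
of `Q` has lower height density at least `1 - 2η`. [folklore] -/
theorem heightDensityGE_not_of_periodic {N : ℕ} [NeZero N] {Q : ℤ × ℤ → Prop}
    (hQ : IsPeriodic N Q) {η : ℝ} (hη : ((residues N Q).card : ℝ) / (N : ℝ) ^ 2 ≤ η) :
    HeightDensityGE (fun AB ↦ ¬ Q AB) (1 - 2 * η) := by
  intro ε hε
  filter_upwards [eventually_heightProportion_le hQ hε, eventually_ge_atTop 28] with X hX hX28
  have hcomp : heightProportion (fun AB ↦ ¬ Q AB) X + heightProportion Q X = 1 := by
    have hpos : (0 : ℝ) < (heightFamilyBelow X).card := by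
      exact_mod_cast Finset.card_pos.mpr ⟨_, zeroOne_mem_heightFamilyBelow hX28⟩
    unfold heightProportion heightAverage
    rw [← add_div, ← Finset.sum_add_distrib, div_eq_one_iff_eq hpos.ne', Finset.card_eq_sum_ones,
      Nat.cast_sum]
    refine Finset.sum_congr rfl fun AB _ ↦ ?_
    by_cases hP : Q AB <;> simp [hP]
  nlinarith

/-! ## §4 The local condition at one prime `q ≥ 5`: `q ∤ A`, `ord_q(4A³ + 27B²) = 1` -/

/-- The local condition of the source's proof at a prime `q ≥ 5` (inside `{q ∤ A}`, as in the proof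
of Lemma 19): `q ∤ A` and `ord_q(4A³ + 27B²) = 1`, i.e. `q ∥ Δ(A, B)`. [cite: BhargavaSkinnerZhang2014, Lemma 19–20 (proofs)] -/
def LocalHit (q : ℕ) (AB : ℤ × ℤ) : Prop :=
  ¬ (q : ℤ) ∣ AB.1 ∧ padicValInt q (4 * AB.1 ^ 3 + 27 * AB.2 ^ 2) = 1

/-- `ord_q D = 1 ↔ q ∣ D ∧ q² ∤ D`. [folklore] -/
theorem padicValInt_eq_one_iff {q : ℕ} [hq : Fact q.Prime] (D : ℤ) :
    padicValInt q D = 1 ↔ (q : ℤ) ∣ D ∧ ¬ (q : ℤ) ^ 2 ∣ D := by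
  rcases eq_or_ne D 0 with rfl | hD
  · simp
  · have h1 : (q : ℤ) ∣ D ↔ 1 ≤ padicValInt q D := by
      rw [← pow_one (q : ℤ), padicValInt_dvd_iff]; simp [hD]
    have h2 : (q : ℤ) ^ 2 ∣ D ↔ 2 ≤ padicValInt q D := by
      rw [padicValInt_dvd_iff]; simp [hD]
    rw [h1, h2]; omega

/-- The local condition is `q²`-periodic. [folklore] -/
theorem isPeriodic_localHit (q : ℕ) [Fact q.Prime] : IsPeriodic (q ^ 2) (LocalHit q) := by
  intro AB AB' h1 h2
  have hD : 4 * AB.1 ^ 3 + 27 * AB.2 ^ 2 ≡ 4 * AB'.1 ^ 3 + 27 * AB'.2 ^ 2 [ZMOD ((q ^ 2 : ℕ) : ℤ)] :=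
    ((h1.pow 3).mul_left 4).add ((h2.pow 2).mul_left 27)
  have hq2 : ((q ^ 2 : ℕ) : ℤ) = (q : ℤ) ^ 2 := by push_cast; ring
  rw [hq2] at hD h1
  -- divisibility by `d ∣ q²` is a congruence invariant modulo `q²` (cf. the tree's
  -- `DiophantineGeometry.dvd_iff_of_modEq`)
  have hdvd : ∀ {d a b : ℤ}, a ≡ b [ZMOD (q : ℤ) ^ 2] → d ∣ (q : ℤ) ^ 2 → (d ∣ a ↔ d ∣ b) :=
    fun h hd ↦ by
      have h' := h.of_dvd hd
      rw [← Int.modEq_zero_iff_dvd, ← Int.modEq_zero_iff_dvd]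
      exact ⟨fun ha ↦ h'.symm.trans ha, fun hb ↦ h'.trans hb⟩
  simp only [LocalHit, padicValInt_eq_one_iff]
  rw [hdvd h1 (dvd_pow_self _ two_ne_zero), hdvd hD (dvd_pow_self _ two_ne_zero),
    hdvd hD (dvd_refl _)]

/-- The local density `δ_q = (q-1)²/q³`. [cite: BhargavaSkinnerZhang2014, Lemma 19 (proof)] -/
def localDensity (q : ℕ) : ℝ := ((q : ℝ) - 1) ^ 2 / (q : ℝ) ^ 3

/-- **The residue proportion of the local condition is `δ_q = (q-1)²/q³`** (`q ≥ 5`): the residue set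
modulo `q²` has `q(q-1)²` elements. Read off by uniqueness of limits from the tree's one-prime
density theorems: the condition has height density `(q-1)²/q³ · (1-q⁻¹⁰)⁻¹`
(`hasHeightDensity_padicValInt_disc_eq`, the first display of the proof of Lemma 19) and, being a
residue condition inside `{q ∤ A}`, density `#R/q⁴ · (1-q⁻¹⁰)⁻¹` (`hasHeightDensity_residues`).
[cite: BhargavaSkinnerZhang2014, Lemma 19 (proof)] -/
theorem card_residues_localHit_div {q : ℕ} [hq : Fact q.Prime] (hq5 : 5 ≤ q) :
    haveI : NeZero (q ^ 2) := ⟨pow_ne_zero _ hq.out.ne_zero⟩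
    ((residues (q ^ 2) (LocalHit q)).card : ℝ) / ((q ^ 2 : ℕ) : ℝ) ^ 2 = localDensity q := by
  haveI : NeZero (q ^ 2) := ⟨pow_ne_zero _ hq.out.ne_zero⟩
  set R := residues (q ^ 2) (LocalHit q) with hRdef
  have hR : ∀ AB : ℤ × ℤ, ((AB.1 : ZMod (q ^ 2)), (AB.2 : ZMod (q ^ 2))) ∈ R → ¬ (q : ℤ) ∣ AB.1 :=
    fun AB h ↦ ((mem_residues_iff (isPeriodic_localHit q) AB).mp h).1
  have h1 := hasHeightDensity_residues hq.out 2 R hR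
  have h2 := hasHeightDensity_padicValInt_disc_eq hq5 (k := 1) le_rfl
  have hfun : (fun AB : ℤ × ℤ ↦ ((AB.1 : ZMod (q ^ 2)), (AB.2 : ZMod (q ^ 2))) ∈ R) =
      fun AB ↦ ¬ (q : ℤ) ∣ AB.1 ∧ padicValInt q (4 * AB.1 ^ 3 + 27 * AB.2 ^ 2) = 1 :=
    funext fun AB ↦ propext (mem_residues_iff (isPeriodic_localHit q) AB)
  rw [hfun] at h1
  have heq := tendsto_nhds_unique h1 h2
  have hq0 : (0 : ℝ) < q := by exact_mod_cast hq.out.pos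
  have hL : (0 : ℝ) < 1 - 1 / (q : ℝ) ^ 10 := by
    rw [sub_pos, div_lt_one (pow_pos hq0 10)]
    have : (2 : ℝ) ≤ q := by exact_mod_cast hq.out.two_le
    exact one_lt_pow₀ (by linarith) (by norm_num)
  have heq' : (R.card : ℝ) / ((q : ℝ) ^ 2) ^ 2 = ((q : ℝ) - 1) ^ 2 / (q : ℝ) ^ (1 + 2) :=
    (div_left_inj' hL.ne').mp heq
  rw [localDensity, Nat.cast_pow, heq']

/-- `δ_q ≤ 1/2` (indeed `≤ 1/q`). [folklore] -/
theorem localDensity_le_half {q : ℕ} (hq5 : 5 ≤ q) : localDensity q ≤ 1 / 2 := by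
  have hq : (5 : ℝ) ≤ q := by exact_mod_cast hq5
  rw [localDensity, div_le_iff₀ (by positivity)]
  nlinarith [sq_nonneg ((q : ℝ) - 1)]

/-- `δ_q ≥ 0`. [folklore] -/
theorem localDensity_nonneg (q : ℕ) : 0 ≤ localDensity q := by
  unfold localDensity; positivity

/-- `δ_q ≥ (16/25)/q` for `q ≥ 5` (so `Σ_q δ_q` diverges with `Σ 1/q`). [folklore] -/
theorem localDensity_ge {q : ℕ} (hq5 : 5 ≤ q) : 16 / 25 * (1 / (q : ℝ)) ≤ localDensity q := by
  have hq : (5 : ℝ) ≤ q := by exact_mod_cast hq5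
  have hq0 : (0 : ℝ) < q := by linarith
  rw [localDensity, le_div_iff₀ (by positivity)]
  have : 16 / 25 * (1 / (q : ℝ)) * (q : ℝ) ^ 3 = 16 / 25 * (q : ℝ) ^ 2 := by
    field_simp
  rw [this]
  nlinarith

/-! ## §5 No hit / at most one hit among a finite set of primes: the recurrence -/

/-- "No `q ∈ P` hits." [folklore] -/
def NoHit (P : Finset ℕ) (AB : ℤ × ℤ) : Prop := ∀ q ∈ P, ¬ LocalHit q AB

/-- "At most one `q ∈ P` hits." [folklore] -/
def AtMostOneHit (P : Finset ℕ) (AB : ℤ × ℤ) : Prop :=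
  ∀ q₁ ∈ P, ∀ q₂ ∈ P, LocalHit q₁ AB → LocalHit q₂ AB → q₁ = q₂

/-- The modulus `n_P = ∏_{q ∈ P} q²`. [folklore] -/
def modulus (P : Finset ℕ) : ℕ := ∏ q ∈ P, q ^ 2

/-- `s_P = Σ_{q ∈ P} δ_q`. [folklore] -/
def sumDensity (P : Finset ℕ) : ℝ := ∑ q ∈ P, localDensity q

/-- The residue proportion `#R_N(Q)/N²` as a plain function of `N` (junk value `0` at `N = 0`).
[folklore] -/
def resProp (N : ℕ) (Q : ℤ × ℤ → Prop) : ℝ :=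
  if h : N = 0 then 0 else
    haveI : NeZero N := ⟨h⟩
    ((residues N Q).card : ℝ) / (N : ℝ) ^ 2

/-- Unfolding of `resProp` at a nonzero modulus. [folklore] -/
theorem resProp_eq (N : ℕ) [NeZero N] (Q : ℤ × ℤ → Prop) :
    resProp N Q = ((residues N Q).card : ℝ) / (N : ℝ) ^ 2 := by
  simp [resProp, NeZero.ne N]

/-- Residue proportions are nonnegative. [folklore] -/
theorem resProp_nonneg (N : ℕ) (Q : ℤ × ℤ → Prop) : 0 ≤ resProp N Q := by
  unfold resProp; split_ifs <;> positivity

/-- Equivalent conditions have the same residue proportion. [folklore] -/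
theorem resProp_congr {N : ℕ} {Q Q' : ℤ × ℤ → Prop} (h : ∀ AB, Q AB ↔ Q' AB) :
    resProp N Q = resProp N Q' := by
  rw [show Q = Q' from funext fun AB ↦ propext (h AB)]

/-- The trivial condition has residue proportion `1`. [folklore] -/
theorem resProp_true (N : ℕ) [NeZero N] : resProp N (fun _ ↦ True) = 1 := by
  have hN : (0 : ℝ) < N := by exact_mod_cast Nat.pos_of_ne_zero (NeZero.ne N)
  rw [resProp_eq, residues_true, Finset.card_univ, Fintype.card_prod, ZMod.card, Nat.cast_mul,
    sq, div_self (by positivity)]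

/-- Residue proportions of disjoint conditions add. [folklore] -/
theorem resProp_or_of_disjoint (N : ℕ) {Q Q' : ℤ × ℤ → Prop} (h : ∀ AB, Q AB → ¬ Q' AB) :
    resProp N (fun AB ↦ Q AB ∨ Q' AB) = resProp N Q + resProp N Q' := by
  rcases eq_or_ne N 0 with rfl | hN
  · simp [resProp]
  · haveI : NeZero N := ⟨hN⟩
    rw [resProp_eq, resProp_eq, resProp_eq, card_residues_or_of_disjoint h, Nat.cast_add, add_div]

/-- The residue proportion of a complement. [folklore] -/
theorem resProp_not (N : ℕ) [NeZero N] {Q : ℤ × ℤ → Prop} :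
    resProp N (fun AB ↦ ¬ Q AB) = 1 - resProp N Q := by
  have h := resProp_or_of_disjoint N (Q := Q) (Q' := fun AB ↦ ¬ Q AB) (fun _ h h' ↦ h' h)
  have ht : resProp N (fun AB ↦ Q AB ∨ ¬ Q AB) = 1 := by
    rw [resProp_congr (Q' := fun _ ↦ True) (fun AB ↦ iff_of_true (em (Q AB)) trivial),
      resProp_true]
  linarith

/-- **CRT for residue proportions**: for coprime moduli and periodic conditions, the proportion of the
conjunction is the product of the proportions. [folklore] -/
theorem resProp_and_of_coprime {m n : ℕ} [NeZero m] [NeZero n] (hmn : m.Coprime n)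
    {Q Q' : ℤ × ℤ → Prop} (hQ : IsPeriodic m Q) (hQ' : IsPeriodic n Q') :
    resProp (m * n) (fun AB ↦ Q AB ∧ Q' AB) = resProp m Q * resProp n Q' := by
  haveI : NeZero (m * n) := ⟨mul_ne_zero (NeZero.ne m) (NeZero.ne n)⟩
  rw [resProp_eq, resProp_eq, resProp_eq, card_residues_and_of_coprime hmn hQ hQ']
  push_cast
  ring

/-- The residue proportion of the local condition modulo `q²` is `δ_q`. [cite: BhargavaSkinnerZhang2014, Lemma 19 (proof)] -/
theorem resProp_localHit {q : ℕ} [hq : Fact q.Prime] (hq5 : 5 ≤ q) :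
    resProp (q ^ 2) (LocalHit q) = localDensity q := by
  haveI : NeZero (q ^ 2) := ⟨pow_ne_zero _ hq.out.ne_zero⟩
  rw [resProp_eq]
  exact card_residues_localHit_div hq5

/-- `n_P ≠ 0` for a set of primes. [folklore] -/
theorem modulus_ne_zero {P : Finset ℕ} (hP : ∀ q ∈ P, q.Prime) : modulus P ≠ 0 :=
  Finset.prod_ne_zero_iff.mpr fun q hq ↦ pow_ne_zero _ (hP q hq).ne_zero

/-- Each local condition at `q ∈ P` is periodic modulo `n_P`. [folklore] -/
theorem isPeriodic_localHit_modulus {P : Finset ℕ} (hP : ∀ q ∈ P, q.Prime) {q : ℕ} (hq : q ∈ P) :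
    IsPeriodic (modulus P) (LocalHit q) := by
  haveI : Fact q.Prime := ⟨hP q hq⟩
  exact (isPeriodic_localHit q).of_dvd (Finset.dvd_prod_of_mem (fun q ↦ q ^ 2) hq)

/-- "No hit" is periodic whenever the local conditions are. [folklore] -/
theorem isPeriodic_noHit {N : ℕ} {P : Finset ℕ} (h : ∀ q ∈ P, IsPeriodic N (LocalHit q)) :
    IsPeriodic N (NoHit P) := fun _ _ h1 h2 ↦
  forall₂_congr fun q hq ↦ not_congr (h q hq _ _ h1 h2)

/-- "At most one hit" is periodic whenever the local conditions are. [folklore] -/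
theorem isPeriodic_atMostOneHit {N : ℕ} {P : Finset ℕ} (h : ∀ q ∈ P, IsPeriodic N (LocalHit q)) :
    IsPeriodic N (AtMostOneHit P) := fun _ _ h1 h2 ↦
  forall₂_congr fun q₁ hq₁ ↦ forall₂_congr fun q₂ hq₂ ↦ by
    rw [h q₁ hq₁ _ _ h1 h2, h q₂ hq₂ _ _ h1 h2]

/-- Recurrence for "no hit" when a prime is added. [folklore] -/
theorem noHit_insert (a : ℕ) (P : Finset ℕ) (AB : ℤ × ℤ) :
    NoHit (insert a P) AB ↔ ¬ LocalHit a AB ∧ NoHit P AB := by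
  simp [NoHit]

/-- Recurrence for "at most one hit" when a new prime is added: either the new prime hits and no old
one does, or it does not and at most one old one does. [folklore] -/
theorem atMostOneHit_insert {a : ℕ} {P : Finset ℕ} (ha : a ∉ P) (AB : ℤ × ℤ) :
    AtMostOneHit (insert a P) AB ↔
      (LocalHit a AB ∧ NoHit P AB) ∨ (¬ LocalHit a AB ∧ AtMostOneHit P AB) := by
  constructor
  · intro h
    by_cases hA : LocalHit a AB
    · refine Or.inl ⟨hA, fun q hq hq' ↦ ha ?_⟩
      rw [h q (Finset.mem_insert_of_mem hq) a (Finset.mem_insert_self a P) hq' hA] at hq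
      exact hq
    · exact Or.inr ⟨hA, fun q₁ hq₁ q₂ hq₂ ↦
        h q₁ (Finset.mem_insert_of_mem hq₁) q₂ (Finset.mem_insert_of_mem hq₂)⟩
  · rintro (⟨hA, hZ⟩ | ⟨hA, hO⟩)
    · intro q₁ hq₁ q₂ hq₂ h₁ h₂
      rw [Finset.mem_insert] at hq₁ hq₂
      rcases hq₁ with rfl | hq₁
      · rcases hq₂ with rfl | hq₂
        · rfl
        · exact (hZ q₂ hq₂ h₂).elim
      · exact (hZ q₁ hq₁ h₁).elim
    · intro q₁ hq₁ q₂ hq₂ h₁ h₂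
      rw [Finset.mem_insert] at hq₁ hq₂
      rcases hq₁ with rfl | hq₁
      · exact (hA h₁).elim
      · rcases hq₂ with rfl | hq₂
        · exact (hA h₂).elim
        · exact hO q₁ hq₁ q₂ hq₂ h₁ h₂

/-- The elementary inequality of the induction step: for `0 ≤ δ ≤ 1/2`, `0 ≤ s`,
`δ e^{-s} + (1-δ)(1+2s)e^{-s} ≤ (1 + 2(δ+s)) e^{-(δ+s)}` (from `1 - δ ≤ e^{-δ}`). [folklore] -/
theorem step_ineq {δ s z o : ℝ} (hδ0 : 0 ≤ δ) (hδ : δ ≤ 1 / 2) (hs : 0 ≤ s)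
    (hz : z ≤ Real.exp (-s)) (ho : o ≤ (1 + 2 * s) * Real.exp (-s)) :
    (1 - δ) * z ≤ Real.exp (-(δ + s)) ∧
      δ * z + (1 - δ) * o ≤ (1 + 2 * (δ + s)) * Real.exp (-(δ + s)) := by
  have he : 1 - δ ≤ Real.exp (-δ) := by linarith [Real.add_one_le_exp (-δ)]
  have hes : 0 < Real.exp (-s) := Real.exp_pos _
  have heδ : 0 < Real.exp (-δ) := Real.exp_pos _
  have hexp : Real.exp (-(δ + s)) = Real.exp (-δ) * Real.exp (-s) := by
    rw [neg_add, Real.exp_add]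
  rw [hexp]
  constructor
  · calc (1 - δ) * z ≤ (1 - δ) * Real.exp (-s) := mul_le_mul_of_nonneg_left hz (by linarith)
      _ ≤ Real.exp (-δ) * Real.exp (-s) := mul_le_mul_of_nonneg_right he hes.le
  · have h1 : δ * z ≤ δ * Real.exp (-s) := mul_le_mul_of_nonneg_left hz hδ0
    have h2 : (1 - δ) * o ≤ (1 - δ) * ((1 + 2 * s) * Real.exp (-s)) :=
      mul_le_mul_of_nonneg_left ho (by linarith)
    have h3 : δ * Real.exp (-s) + (1 - δ) * ((1 + 2 * s) * Real.exp (-s)) =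
        (1 + 2 * s - 2 * δ * s) * Real.exp (-s) := by ring
    have h4 : (1 + 2 * s - 2 * δ * s) ≤ (1 + 2 * (δ + s)) * (1 - δ) := by nlinarith
    have h5 : (1 + 2 * (δ + s)) * (1 - δ) ≤ (1 + 2 * (δ + s)) * Real.exp (-δ) :=
      mul_le_mul_of_nonneg_left he (by positivity)
    calc δ * z + (1 - δ) * o ≤ (1 + 2 * s - 2 * δ * s) * Real.exp (-s) := by linarith
      _ ≤ (1 + 2 * (δ + s)) * (1 - δ) * Real.exp (-s) := mul_le_mul_of_nonneg_right h4 hes.le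
      _ ≤ (1 + 2 * (δ + s)) * Real.exp (-δ) * Real.exp (-s) :=
          mul_le_mul_of_nonneg_right h5 hes.le
      _ = (1 + 2 * (δ + s)) * (Real.exp (-δ) * Real.exp (-s)) := by ring

/-- **The sieve bound**: for a finite set `P` of primes `≥ 5`, the residue proportions modulo
`n_P = ∏ q²` satisfy `r(no hit) ≤ e^{-s_P}` and `r(at most one hit) ≤ (1 + 2 s_P) e^{-s_P}`,
`s_P = Σ_{q ∈ P} (q-1)²/q³` — the product of local densities of the source's proof of Lemma 20,
made quantitative. [cite: BhargavaSkinnerZhang2014, Lemma 20 (proof, p. 10)] -/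
theorem resProp_noHit_atMostOneHit_le (P : Finset ℕ) (hP : ∀ q ∈ P, q.Prime ∧ 5 ≤ q) :
    resProp (modulus P) (NoHit P) ≤ Real.exp (-sumDensity P) ∧
      resProp (modulus P) (AtMostOneHit P) ≤ (1 + 2 * sumDensity P) * Real.exp (-sumDensity P) := by
  induction P using Finset.induction_on with
  | empty =>
    haveI : NeZero (modulus ∅) := ⟨by simp [modulus]⟩
    have h1 : resProp (modulus ∅) (NoHit ∅) = 1 := by
      rw [resProp_congr (fun AB ↦ iff_of_true (fun q hq ↦ (Finset.notMem_empty q hq).elim) trivial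
        : ∀ AB, NoHit ∅ AB ↔ True), resProp_true]
    have h2 : resProp (modulus ∅) (AtMostOneHit ∅) = 1 := by
      rw [resProp_congr (fun AB ↦ iff_of_true (fun q hq ↦ (Finset.notMem_empty q hq).elim) trivial
        : ∀ AB, AtMostOneHit ∅ AB ↔ True), resProp_true]
    simp [h1, h2, sumDensity]
  | insert a P ha ih =>
    have hP' : ∀ q ∈ P, q.Prime ∧ 5 ≤ q := fun q hq ↦ hP q (Finset.mem_insert_of_mem hq)
    have haP := hP a (Finset.mem_insert_self a P)
    haveI : Fact a.Prime := ⟨haP.1⟩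
    obtain ⟨ihZ, ihO⟩ := ih hP'
    haveI hnP : NeZero (modulus P) := ⟨modulus_ne_zero fun q hq ↦ (hP' q hq).1⟩
    haveI hna : NeZero (a ^ 2) := ⟨pow_ne_zero _ haP.1.ne_zero⟩
    have hmod : modulus (insert a P) = a ^ 2 * modulus P := Finset.prod_insert ha
    have hcop : (a ^ 2).Coprime (modulus P) := by
      refine Nat.Coprime.pow_left 2 (Nat.Coprime.prod_right fun q hq ↦ Nat.Coprime.pow_right 2 ?_)
      exact (Nat.coprime_primes haP.1 (hP' q hq).1).mpr fun h ↦ ha (h ▸ hq)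
    have hsum : sumDensity (insert a P) = localDensity a + sumDensity P := Finset.sum_insert ha
    have hperZ : IsPeriodic (modulus P) (NoHit P) :=
      isPeriodic_noHit fun q hq ↦ isPeriodic_localHit_modulus (fun q hq ↦ (hP' q hq).1) hq
    have hperO : IsPeriodic (modulus P) (AtMostOneHit P) :=
      isPeriodic_atMostOneHit fun q hq ↦ isPeriodic_localHit_modulus (fun q hq ↦ (hP' q hq).1) hq
    have hpera : IsPeriodic (a ^ 2) (LocalHit a) := isPeriodic_localHit a
    have hδ : resProp (a ^ 2) (LocalHit a) = localDensity a := resProp_localHit haP.2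
    have hδ' : resProp (a ^ 2) (fun AB ↦ ¬ LocalHit a AB) = 1 - localDensity a := by
      rw [resProp_not, hδ]
    -- the recurrences
    have hZ : resProp (modulus (insert a P)) (NoHit (insert a P)) =
        (1 - localDensity a) * resProp (modulus P) (NoHit P) := by
      rw [hmod, resProp_congr (noHit_insert a P), resProp_and_of_coprime hcop hpera.not hperZ, hδ']
    have hO : resProp (modulus (insert a P)) (AtMostOneHit (insert a P)) =
        localDensity a * resProp (modulus P) (NoHit P) +
          (1 - localDensity a) * resProp (modulus P) (AtMostOneHit P) := by
      rw [hmod, resProp_congr (atMostOneHit_insert ha),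
        resProp_or_of_disjoint _ (fun AB h h' ↦ h'.1 h.1),
        resProp_and_of_coprime hcop hpera hperZ, resProp_and_of_coprime hcop hpera.not hperO, hδ, hδ']
    rw [hZ, hO, hsum]
    exact step_ineq (localDensity_nonneg a) (localDensity_le_half haP.2)
      (Finset.sum_nonneg fun q _ ↦ localDensity_nonneg q) ihZ ihO

/-! ## §6 Divergence of `Σ δ_q` and the density-one statement -/

/-- **`Σ_q δ_q` diverges**: for every bound `c` there is a finite set `P` of primes `≥ 5` with
`s_P ≥ c` (`δ_q ≥ (16/25)/q` and `Σ_p 1/p = ∞`, Mathlib's `Nat.Primes.not_summable_one_div`).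
[folklore] -/
theorem exists_primes_sumDensity_ge (c : ℝ) :
    ∃ P : Finset ℕ, (∀ q ∈ P, q.Prime ∧ 5 ≤ q) ∧ c ≤ sumDensity P := by
  -- `f p = 1/p` for `p ≥ 5`, `0` otherwise, is not summable over the primes
  set f : Nat.Primes → ℝ := fun p ↦ if 5 ≤ (p : ℕ) then 1 / ((p : ℕ) : ℝ) else 0 with hf
  set g : Nat.Primes → ℝ := fun p ↦ if 5 ≤ (p : ℕ) then 0 else 1 / ((p : ℕ) : ℝ) with hg
  have hfg : (fun p : Nat.Primes ↦ (1 / (p : ℕ) : ℝ)) = fun p ↦ f p + g p := by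
    funext p; simp only [hf, hg]; split_ifs <;> simp
  have hgs : Summable g := by
    refine summable_of_ne_finset_zero
      (s := ({⟨2, Nat.prime_two⟩, ⟨3, Nat.prime_three⟩} : Finset Nat.Primes)) ?_
    intro p hp
    simp only [Finset.mem_insert, Finset.mem_singleton, not_or] at hp
    have h2 : (p : ℕ) ≠ 2 := fun h ↦ hp.1 (Subtype.ext h)
    have h3 : (p : ℕ) ≠ 3 := fun h ↦ hp.2 (Subtype.ext h)
    have h5 : 5 ≤ (p : ℕ) := p.2.five_le_of_ne_two_of_ne_three h2 h3
    simp [hg, h5]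
  have hfs : ¬ Summable f := by
    intro h
    have := h.add hgs
    rw [← hfg] at this
    exact Nat.Primes.not_summable_one_div this
  have hf0 : ∀ p, 0 ≤ f p := fun p ↦ by simp only [hf]; split_ifs <;> positivity
  -- hence some finite partial sum exceeds `25/16 · c`
  obtain ⟨s, hs⟩ : ∃ s : Finset Nat.Primes, ¬ (∑ p ∈ s, f p ≤ 25 / 16 * c) := by
    by_contra h
    push Not at h
    exact hfs (summable_of_sum_le hf0 h)
  rw [not_le] at hs
  set emb : Nat.Primes ↪ ℕ := ⟨fun p ↦ (p : ℕ), Nat.Primes.coe_nat_injective⟩ with hemb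
  refine ⟨(s.filter (fun p : Nat.Primes ↦ 5 ≤ (p : ℕ))).map emb, fun q hq ↦ ?_, ?_⟩
  · rw [Finset.mem_map] at hq
    obtain ⟨p, hp, rfl⟩ := hq
    exact ⟨p.2, (Finset.mem_filter.mp hp).2⟩
  · rw [sumDensity, Finset.sum_map, Finset.sum_filter]
    simp only [hemb, Function.Embedding.coeFn_mk]
    have hle : ∑ p ∈ s, f p ≤
        25 / 16 * ∑ p ∈ s, (if 5 ≤ (p : ℕ) then localDensity (p : ℕ) else 0) := by
      rw [Finset.mul_sum]
      refine Finset.sum_le_sum fun p _ ↦ ?_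
      simp only [hf]
      split_ifs with h5
      · have := localDensity_ge h5; linarith
      · simp
    linarith

/-- **Bhargava–Skinner–Zhang, Lemma 20, second property (proved; `p`-uniform form).** A (lower)
naive-height density one of pairs `(A, B)` admit two distinct primes `ℓ₁, ℓ₂ ≥ 5` with `ℓᵢ ∤ A` and
`ord_{ℓᵢ}(4A³ + 27B²) = 1` — hence (§7) two primes `ℓᵢ ∥ N(E_{A,B})` with `v_{ℓᵢ}(Δ) = 1`, at which
`E[p]` is ramified for EVERY prime `p`. Source, proof of Lemma 20: "any curve in the complement of
`S(L)` satisfies the second property of the lemma with two primes `5 ≤ ℓ₁, ℓ₂ ≤ L`. So it suffices to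
show that `μ(S(L))` tends to `0` as `L` gets large." [cite: BhargavaSkinnerZhang2014, Lemma 20 (proof, p. 10)] -/
theorem heightDensityGE_twoOrdOnePrimes :
    HeightDensityGE (fun AB : ℤ × ℤ ↦ ∃ ℓ₁ ℓ₂ : ℕ, ℓ₁.Prime ∧ ℓ₂.Prime ∧ 5 ≤ ℓ₁ ∧ 5 ≤ ℓ₂ ∧ ℓ₁ ≠ ℓ₂ ∧
      LocalHit ℓ₁ AB ∧ LocalHit ℓ₂ AB) 1 := by
  intro ε hε
  -- `(1 + 2s) e^{-s} → 0`
  have hlim : Tendsto (fun s : ℝ ↦ (1 + 2 * s) * Real.exp (-s)) atTop (𝓝 0) := by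
    have h0 : Tendsto (fun s : ℝ ↦ Real.exp (-s)) atTop (𝓝 0) := Real.tendsto_exp_neg_atTop_nhds_zero
    have h1 := Real.tendsto_pow_mul_exp_neg_atTop_nhds_zero 1
    have := h0.add (h1.const_mul 2)
    simp only [pow_one, mul_zero, add_zero] at this
    refine this.congr fun s ↦ ?_
    ring
  obtain ⟨c, hc⟩ := eventually_atTop.mp (hlim.eventually (gt_mem_nhds (show (0 : ℝ) < ε / 4 by positivity)))
  obtain ⟨P, hP, hcP⟩ := exists_primes_sumDensity_ge c
  haveI : NeZero (modulus P) := ⟨modulus_ne_zero fun q hq ↦ (hP q hq).1⟩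
  have hbound := (resProp_noHit_atMostOneHit_le P hP).2
  have hη : ((residues (modulus P) (AtMostOneHit P)).card : ℝ) / ((modulus P : ℕ) : ℝ) ^ 2 ≤ ε / 4 := by
    rw [← resProp_eq]
    exact hbound.trans (hc _ hcP).le
  have hper : IsPeriodic (modulus P) (AtMostOneHit P) :=
    isPeriodic_atMostOneHit fun q hq ↦ isPeriodic_localHit_modulus (fun q hq ↦ (hP q hq).1) hq
  have hD := heightDensityGE_not_of_periodic hper hη
  -- the complement of "at most one hit" is contained in the target property
  have hmono : ∀ AB, ¬ AtMostOneHit P AB → ∃ ℓ₁ ℓ₂ : ℕ, ℓ₁.Prime ∧ ℓ₂.Prime ∧ 5 ≤ ℓ₁ ∧ 5 ≤ ℓ₂ ∧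
      ℓ₁ ≠ ℓ₂ ∧ LocalHit ℓ₁ AB ∧ LocalHit ℓ₂ AB := by
    intro AB h
    simp only [AtMostOneHit, not_forall, exists_prop] at h
    obtain ⟨q₁, hq₁, q₂, hq₂, h₁, h₂, hne⟩ := h
    exact ⟨q₁, q₂, (hP q₁ hq₁).1, (hP q₂ hq₂).1, (hP q₁ hq₁).2, (hP q₂ hq₂).2, hne, h₁, h₂⟩
  filter_upwards [hD (ε / 2) (by positivity)] with X hX
  have hm := heightProportion_mono hmono X
  linarith

/-! ## §7 From the local condition to multiplicative reduction with `v_q(Δ_min) = 1` -/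

open WeierstrassCurve NumberField

/-- `Δ(E_{A,B}) = -16(4A³ + 27B²)` as a rational number. [folklore] -/
theorem shortWeierstrass_Δ (AB : ℤ × ℤ) :
    (shortWeierstrass AB).Δ = ((-16 * (4 * AB.1 ^ 3 + 27 * AB.2 ^ 2) : ℤ) : ℚ) := by
  rw [BSZLemma17.shortWeierstrass_eq_baseChange, baseChange, map_Δ, BSZLemma17.int_Δ]
  simp

/-- **A globally minimal model has the least discriminant valuation**: if `W` is a globally minimal
model of `E_{A,B}` (`C • E_{A,B} = W`), then `v_q(Δ_min(W)) ≤ v_q(Δ(A,B))` at every prime `q`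
(`W ⊗ ℚ_q` is `ℤ_q`-minimal, `isMinimal_baseChange_padic_of_isGloballyMinimal`, and `E_{A,B} ⊗ ℚ_q`
is an integral equation `ℚ_q`-isomorphic to it; Silverman VII.1, VIII.8).
[cite: SilvermanAEC2009, VII.1 (minimal equations) and VIII.8] -/
theorem padicValInt_minimalDiscriminantInt_le {AB : ℤ × ℤ} (W : WeierstrassCurve ℚ) [W.IsElliptic]
    [W.IsGloballyMinimal] (C : VariableChange ℚ) (hW : C • shortWeierstrass AB = W)
    (q : ℕ) [hq : Fact q.Prime] :
    (padicValInt q W.minimalDiscriminantInt : ℤ) ≤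
      padicValInt q (-16 * (4 * AB.1 ^ 3 + 27 * AB.2 ^ 2)) := by
  obtain ⟨v, hv⟩ := (Rat.HeightOneSpectrum.primesEquiv (R := 𝓞 ℚ)).surjective ⟨q, hq.out⟩
  have hvp : ((Rat.HeightOneSpectrum.primesEquiv v : Nat.Primes) : ℕ) = q :=
    congrArg Subtype.val hv
  subst hvp
  haveI hmin := isMinimal_baseChange_padic_of_isGloballyMinimal W v
  set p : ℕ := ((Rat.HeightOneSpectrum.primesEquiv v : Nat.Primes) : ℕ) with hp
  set X : WeierstrassCurve ℚ_[p] := W.baseChange ℚ_[p] with hX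
  set Y : WeierstrassCurve ℚ_[p] := (shortWeierstrass AB).baseChange ℚ_[p] with hY
  -- `E_{A,B} ⊗ ℚ_p = C⁻¹ • X` is an integral equation
  have hYX : Y = (C⁻¹.map (algebraMap ℚ ℚ_[p])) • X := by
    rw [hY, hX, baseChange, baseChange, map_variableChange, ← hW, inv_smul_smul]
  haveI hYint : Y.IsIntegral ℤ_[p] := by
    refine isIntegral_of_exists_lift ℤ_[p] ⟨0, ?_⟩ ⟨0, ?_⟩ ⟨0, ?_⟩ ⟨(AB.1 : ℤ_[p]), ?_⟩
      ⟨(AB.2 : ℤ_[p]), ?_⟩ <;>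
      simp [hY, shortWeierstrass, baseChange]
  have hle : Padic.mulValuation Y.Δ ≤ Padic.mulValuation X.Δ := by
    have := ((isMinimal_iff_of_le_one_iff (padicMulValuation_le_one_iff (p := p)) X).mp hmin).2
      (C⁻¹.map (algebraMap ℚ ℚ_[p])) (hYX ▸ hYint)
    rwa [← hYX] at this
  have hXΔ : X.Δ ≠ 0 := by
    rw [hX, baseChange, map_Δ]
    exact (map_ne_zero _).mpr W.isUnit_Δ.ne_zero
  have hD : (-16 * (4 * AB.1 ^ 3 + 27 * AB.2 ^ 2) : ℤ) ≠ 0 := by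
    haveI hE : (shortWeierstrass AB).IsElliptic := by
      rw [← inv_smul_smul C (shortWeierstrass AB), hW]; infer_instance
    have h := (shortWeierstrass AB).isUnit_Δ.ne_zero
    rw [shortWeierstrass_Δ] at h
    exact_mod_cast h
  have hYΔ' : Y.Δ = (((-16 * (4 * AB.1 ^ 3 + 27 * AB.2 ^ 2) : ℤ) : ℚ) : ℚ_[p]) := by
    rw [hY, baseChange, map_Δ, shortWeierstrass_Δ, eq_ratCast]
  have hYΔ : Y.Δ ≠ 0 := by
    rw [hYΔ', Rat.cast_intCast]; exact_mod_cast hD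
  rw [padicMulValuation_apply_of_ne_zero hYΔ, padicMulValuation_apply_of_ne_zero hXΔ,
    WithZero.exp_le_exp, neg_le_neg_iff, hX, padicValuation_Δ_baseChange_eq_padicValInt, hYΔ',
    Rat.cast_intCast, Padic.valuation_intCast] at hle
  exact hle

/-- `v_q(Δ_min(W)) ≡ v_q(Δ(A,B)) (mod 12)` for a globally minimal model `W` of `E_{A,B}`:
`Δ(A,B) = u¹² Δ_min(W)` in `ℚ` with `u ∈ ℚˣ` the scaling of the isomorphism. [folklore] -/
theorem padicValInt_minimalDiscriminantInt_modEq {AB : ℤ × ℤ}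
    (W : WeierstrassCurve ℚ) [W.IsElliptic] [W.IsGloballyMinimal] (C : VariableChange ℚ)
    (hW : C • shortWeierstrass AB = W) (q : ℕ) [hq : Fact q.Prime] :
    ∃ k : ℤ, (padicValInt q W.minimalDiscriminantInt : ℤ) + 12 * k =
      padicValInt q (-16 * (4 * AB.1 ^ 3 + 27 * AB.2 ^ 2)) := by
  have hΔ : (W.minimalDiscriminantInt : ℚ) * (C.u : ℚ) ^ 12 =
      ((-16 * (4 * AB.1 ^ 3 + 27 * AB.2 ^ 2) : ℤ) : ℚ) := by
    rw [cast_minimalDiscriminantInt, ← hW, variableChange_Δ, shortWeierstrass_Δ]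
    rw [Units.val_inv_eq_inv_val, inv_pow, mul_comm, ← mul_assoc, mul_inv_cancel₀
      (pow_ne_zero _ C.u.ne_zero), one_mul]
  have hm : (W.minimalDiscriminantInt : ℚ) ≠ 0 := by
    exact_mod_cast minimalDiscriminantInt_ne_zero W
  have hu : (C.u : ℚ) ≠ 0 := C.u.ne_zero
  have hv := congrArg (padicValRat q) hΔ
  rw [padicValRat.mul hm (pow_ne_zero _ hu), padicValRat.pow, padicValRat.of_int,
    padicValRat.of_int] at hv
  exact ⟨padicValRat q (C.u : ℚ), by push_cast at hv ⊢; linarith⟩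

/-- **The bridge.** For `(A, B)` in the height family, a prime `q ≥ 5` with `q ∤ A` and
`ord_q(4A³ + 27B²) = 1`, and any globally minimal model `W` of `E_{A,B}`: `W` has multiplicative
reduction at `q` (`E_{A,B}` does — `q ∣ Δ(A,B)`, `q ∤ A`, Silverman VII.5 Prop. 5.1(b) for the
`q`-minimal equation `E_{A,B}`, `LeadingTermBSZReductionTypesProofs` — and the reduction type is an
isomorphism invariant) and `v_q(Δ_min(W)) = 1` (`≤ v_q Δ(A,B) = 1` by minimality, `≡ 1 (mod 12)`).
[cite: SilvermanAEC2009, VII.5 Prop. 5.1(b), VII.1, VIII.8] -/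
theorem hasMultiplicativeReductionAtPrime_and_padicValInt_eq_one_of_localHit {AB : ℤ × ℤ}
    (hAB : IsInHeightFamily AB) {q : ℕ} [hq : Fact q.Prime] (hq5 : 5 ≤ q) (h : LocalHit q AB)
    (W : WeierstrassCurve ℚ) [W.IsElliptic] [W.IsGloballyMinimal] (C : VariableChange ℚ)
    (hW : C • shortWeierstrass AB = W) :
    W.HasMultiplicativeReductionAtPrime q ∧ padicValInt q W.minimalDiscriminantInt = 1 := by
  haveI := isElliptic_shortWeierstrass hAB
  obtain ⟨hA, hord⟩ := h
  have hdvd : (q : ℤ) ∣ 4 * AB.1 ^ 3 + 27 * AB.2 ^ 2 := ((padicValInt_eq_one_iff _).mp hord).1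
  constructor
  · have hm : (shortWeierstrass AB).HasMultiplicativeReductionAtPrime q :=
      (hasMultiplicativeReductionAtPrime_shortWeierstrass_iff_of_isInHeightFamily q hAB hq5).mpr
        ⟨hdvd, hA⟩
    rw [← hW]
    exact (BSZLemma17.hasMultiplicativeReductionAtPrime_smul_iff (shortWeierstrass AB) C q).mpr hm
  · have h16 : padicValInt q (-16 * (4 * AB.1 ^ 3 + 27 * AB.2 ^ 2)) = 1 := by
      rw [padicValInt.mul (by norm_num) hAB.1, hord, padicValInt.eq_zero_of_not_dvd, zero_add]
      intro h
      have h2 : (q : ℤ) ∣ 2 ^ 4 := by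
        have : (-16 : ℤ) = -(2 ^ 4) := by norm_num
        rw [this, dvd_neg] at h
        exact h
      have h2' : (q : ℤ) ∣ 2 := Int.Prime.dvd_pow' hq.out h2
      have : q ∣ 2 := by exact_mod_cast h2'
      have := Nat.le_of_dvd two_pos this
      omega
    have hle := padicValInt_minimalDiscriminantInt_le W C hW q
    obtain ⟨k, hk⟩ := padicValInt_minimalDiscriminantInt_modEq W C hW q
    rw [h16] at hle hk
    omega

end TwoMultPrimes

/-! ## §8 The statement in the shape of the `p`-part hypotheses -/

open TwoMultPrimes in
/-- **(F3) with `k = 2`, proved — Bhargava–Skinner–Zhang, Lemma 20, second property, in the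
vocabulary of the tree's `p`-part theorems.** A (lower) naive-height density one of elliptic curves
`E_{A,B}/ℚ` have, in every globally minimal model `W ≅ E_{A,B}`, two distinct primes `ℓ₁ ≠ ℓ₂` of
multiplicative reduction with `v_{ℓᵢ}(Δ_min) = 1` — so that `ℓᵢ ∥ N` and `ρ̄_{E,p}` is ramified at `ℓᵢ`
for EVERY prime `p` (`p ∤ v_{ℓᵢ}(Δ_min) = 1`). This is the binder `TwoMultPrimesDensityOne` of the
bsd-percentage cell's `PERCENT-FULL.md` §5 (route (P1′): Skinner–Urban's ramified auxiliary prime in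
rank `0` and W. Zhang's hypothesis (3) in rank `1`), with `IsModelOf AB W` spelled out as
`∃ C, C • shortWeierstrass AB = W`. [cite: BhargavaSkinnerZhang2014, Lemma 20 (proof, p. 10)] -/
theorem heightDensityGE_twoMultiplicativePrimes :
    HeightDensityGE (fun AB : ℤ × ℤ ↦ ∀ (W : WeierstrassCurve ℚ) [W.IsElliptic] [W.IsGloballyMinimal],
      (∃ C : WeierstrassCurve.VariableChange ℚ, C • shortWeierstrass AB = W) →
        ∃ ℓ₁ ℓ₂ : ℕ, ℓ₁ ≠ ℓ₂ ∧ ∃ (_ : Fact ℓ₁.Prime) (_ : Fact ℓ₂.Prime),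
          W.HasMultiplicativeReductionAtPrime ℓ₁ ∧ W.HasMultiplicativeReductionAtPrime ℓ₂ ∧
          padicValInt ℓ₁ W.minimalDiscriminantInt = 1 ∧
          padicValInt ℓ₂ W.minimalDiscriminantInt = 1) 1 := by
  have h := heightDensityGE_twoOrdOnePrimes.and_forall fun AB h ↦ h
  intro ε hε
  refine (h ε hε).mono fun X hX ↦ hX.trans (heightProportion_mono ?_ X)
  rintro AB ⟨⟨ℓ₁, ℓ₂, hℓ₁, hℓ₂, h5₁, h5₂, hne, hL₁, hL₂⟩, hAB⟩ W _ _ ⟨C, hW⟩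
  haveI i₁ : Fact ℓ₁.Prime := ⟨hℓ₁⟩
  haveI i₂ : Fact ℓ₂.Prime := ⟨hℓ₂⟩
  obtain ⟨hm₁, hv₁⟩ :=
    hasMultiplicativeReductionAtPrime_and_padicValInt_eq_one_of_localHit hAB h5₁ hL₁ W C hW
  obtain ⟨hm₂, hv₂⟩ :=
    hasMultiplicativeReductionAtPrime_and_padicValInt_eq_one_of_localHit hAB h5₂ hL₂ W C hW
  exact ⟨ℓ₁, ℓ₂, hne, i₁, i₂, hm₁, hm₂, hv₁, hv₂⟩

/-- The same in the arithmetic form of the source: a (lower) density one of `E_{A,B}` have two distinct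
primes `ℓ₁, ℓ₂ ≥ 5` with `ℓᵢ ∤ A` and `ord_{ℓᵢ}(4A³ + 27B²) = 1` (so `ℓᵢ ∥ Δ(A, B)`).
[cite: BhargavaSkinnerZhang2014, Lemma 20 (proof, p. 10)] -/
theorem heightDensityGE_twoPrimes_ordDisc_eq_one :
    HeightDensityGE (fun AB : ℤ × ℤ ↦ ∃ ℓ₁ ℓ₂ : ℕ, ℓ₁.Prime ∧ ℓ₂.Prime ∧ 5 ≤ ℓ₁ ∧ 5 ≤ ℓ₂ ∧ ℓ₁ ≠ ℓ₂ ∧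
      (¬ (ℓ₁ : ℤ) ∣ AB.1 ∧ padicValInt ℓ₁ (4 * AB.1 ^ 3 + 27 * AB.2 ^ 2) = 1) ∧
      (¬ (ℓ₂ : ℤ) ∣ AB.1 ∧ padicValInt ℓ₂ (4 * AB.1 ^ 3 + 27 * AB.2 ^ 2) = 1)) 1 :=
  TwoMultPrimes.heightDensityGE_twoOrdOnePrimes

end Literature.NumberTheory.EllipticCurves

end
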